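import Summits.QuantumFields.YangMills.Theorems.LuscherReductionRunningReductionLatticeTopLower
import Summits.QuantumFields.YangMills.Theorems.LuscherReductionOneSiteLevelsValleyFar
import Summits.QuantumFields.YangMills.Theorems.FemtoTransferGapLevelsDecay
import Summits.QuantumFields.YangMills.Theorems.FemtoTransferGapRungW1up
import HarnessLib

/-!
# Hilbert–Schmidt ratio bound on the `L³` torus: `Σ_{j≤n} (λ_j/λ_0)² ≤ C_L · β^{N_L}` uniformly in `n`, for `β ≥ 54`
# (sub-stub C5a of the fixed-lattice programme COARSE(L₀): the S1 half of COARSE-TAIL(L₁) — route `LuscherReduction`, crux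
# `TwistedTraceScaling` stmt-QuantumFields-20203 S-BASE `stub_fixedLatticeTraceLaw`; card `pub/ym-fleet/ym-luscher-20007-p1/Lines-base-coarse-cut.md`)

The closed child `OneSiteTail` (stmt-QuantumFields-20204) was proved as S1 + S2: S1 = `OST.hs_ratio` (`Σ_{j≤n} x_j(B)² ≤ C·B⁹` at one
site, from `Σ λ_j² ≤ (sup K)²` and the Gaussian floor `λ_0 ≥ c(B)³ e^{−E₀λ_b−…}`), S2 = the `B`-uniform window floor.  COARSE-TAIL(L₁), the
fixed-lattice twin in the cut of S-BASE (`TwoLattice.Base.fixedLatticeTraceLaw_of_coarse`), splits the same way; this file is its S1 on the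
torus `(ℤ/L)³` for every `L`:

* `card_edge_three : |E| = 3L³`, `latCE_eq_linkCE_pow : c_β^{|E|} = linkCE(β)^{L³}`;
* `latCE_ge_gauss_pow` — Gaussian floor of the free row sum: `((1 − 27/β)·e^{6β}√(π/β)⁹/(2π²)³)^{L³} ≤ latCE L β` (tree `gauss_le_linkCE`);
* ★ `lat_hs_ratio_explicit` — for `β ≥ 54` and every `n`,
  `Σ_{j≤n} (λ_j/λ_0)² ≤ (e^{8|P|+2|E|} · (5⁸(8β+1)¹⁹)^{2|E|} · (2(2π²)³β⁵)^{L³})²`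
  (from the tree's `sum_levelValue_sq_le` with `sup K ≤ e^{2β|E|}`, the polynomial floor `levelValue_zero_ge_poly` of
  `…LatticeTopLower.lean`, and `e^{4β|E|} = (e^{6β})^{2L³}`), and the packaged form
  ★ `lat_hs_ratio : ∃ C N β0, ∀ β ≥ β0, ∀ n, Σ_{j≤n} (λ_j/λ_0)² ≤ C·β^N` (`N = 2(38|E| + 5L³) = 238L³`).

HONEST FRAMING: crude polynomial bookkeeping (the true ratio is `O_L(1)`); the S2 half of COARSE-TAIL (a `β`-uniform window count, which needs
the COARSE-UPPER machinery in subspace mode) is NOT here; femto rung R2b1; not a gap, not Clay.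
-/

set_option autoImplicit false

noncomputable section

open MeasureTheory Filter Topology Real
open scoped Matrix ComplexConjugate BigOperators
open Literature.MathematicalPhysics.QuantumFieldTheory
open Literature.MathematicalPhysics.QuantumLattice

namespace Summit.QuantumFields.YangMills.Theorems.FemtoTransferGap

variable (L : ℕ) [NeZero L]

/-! ## §1 Counting: `|E| = 3L³`, `c_β^{|E|} = linkCE(β)^{L³}` -/

/-- The torus `(ℤ/L)³` has `3L³` positively oriented links. [folklore] -/
theorem card_edge_three : Fintype.card (Edge 3 L) = 3 * L ^ 3 := by
  rw [Fintype.card_prod, Fintype.card_pi, Finset.prod_const, Finset.card_univ, Fintype.card_fin, ZMod.card]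
  ring

/-- The torus `(ℤ/L)³` has `3L³` plaquettes. [folklore] -/
theorem card_plaquette_three : Fintype.card (Plaquette 3 L) = 3 * L ^ 3 := by
  rw [Fintype.card_prod, Fintype.card_pi, Finset.prod_const, Finset.card_univ, Fintype.card_fin, ZMod.card]
  have h : Fintype.card {p : Fin 3 × Fin 3 // p.1 < p.2} = 3 := by decide
  rw [h]; ring

/-- `c_β^{|E|} = (c_β³)^{L³} = linkCE(β)^{L³}`. [folklore] -/
theorem latCE_eq_linkCE_pow (β : ℝ) : latCE L β = linkCE β ^ (L ^ 3) := by
  unfold latCE linkCE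
  rw [card_edge_three, card_edge_one, ← pow_mul]

/-- **Gaussian floor of the free row sum**: `((1 − 27/β)·e^{6β}√(π/β)⁹/(2π²)³)^{L³} ≤ c_β^{|E|}` (`β ≥ 27`). [cite: MontvayMunster1994, §3.2.3 (3.97) p.121] -/
theorem latCE_ge_gauss_pow {β : ℝ} (hβ : 27 ≤ β) :
    ((1 - 27 / β) * (Real.exp (6 * β) * Real.sqrt (π / β) ^ 9 / (2 * π ^ 2) ^ 3)) ^ (L ^ 3) ≤ latCE L β := by
  have hβ0 : 0 < β := by linarith
  rw [latCE_eq_linkCE_pow]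
  refine pow_le_pow_left₀ ?_ (gauss_le_linkCE hβ0) _
  have h1 : 0 ≤ 1 - 27 / β := by rw [sub_nonneg, div_le_one hβ0]; exact hβ
  positivity

/-! ## §2 The Hilbert–Schmidt ratio -/

/-- A crude floor `e^{6β}·β^{−5}/(2·(2π²)³) ≤ (1 − 27/β)·e^{6β}√(π/β)⁹/(2π²)³` for `β ≥ 54` (`√(π/β)⁹ ≥ β^{−5}` for `β ≥ 1`). [folklore] -/
theorem gauss_floor_ge {β : ℝ} (hβ : 54 ≤ β) :
    Real.exp (6 * β) * (β ^ 5)⁻¹ / (2 * (2 * π ^ 2) ^ 3) ≤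
      (1 - 27 / β) * (Real.exp (6 * β) * Real.sqrt (π / β) ^ 9 / (2 * π ^ 2) ^ 3) := by
  have hβ0 : 0 < β := by linarith
  have hβ1 : 1 ≤ β := by linarith
  have hπ := Real.pi_pos
  have hhalf : (1 / 2 : ℝ) ≤ 1 - 27 / β := by
    have : 27 / β ≤ 1 / 2 := by rw [div_le_iff₀ hβ0]; linarith
    linarith
  -- `√(π/β)⁹ ≥ β^{-5}`
  have hsq : (β ^ 5)⁻¹ ≤ Real.sqrt (π / β) ^ 9 := by
    have hs1 : 1 / Real.sqrt β ≤ Real.sqrt (π / β) := by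
      rw [Real.sqrt_div hπ.le, div_le_div_iff_of_pos_right (Real.sqrt_pos.2 hβ0)]
      rw [show (1 : ℝ) = Real.sqrt 1 from Real.sqrt_one.symm]
      exact Real.sqrt_le_sqrt (by linarith [Real.pi_gt_three])
    have hs0 : 0 ≤ 1 / Real.sqrt β := by positivity
    have h9 : (1 / Real.sqrt β) ^ 9 ≤ Real.sqrt (π / β) ^ 9 := pow_le_pow_left₀ hs0 hs1 9
    refine le_trans ?_ h9
    -- `(1/√β)^9 = 1/(β^4 √β) ≥ 1/β^5` since `√β ≤ β`
    have hsβ : 0 < Real.sqrt β := Real.sqrt_pos.2 hβ0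
    have hsle : Real.sqrt β ≤ β := by
      rw [Real.sqrt_le_left (by linarith)]
      nlinarith
    have e : (1 / Real.sqrt β) ^ 9 = (β ^ 4 * Real.sqrt β)⁻¹ := by
      rw [div_pow, one_pow, one_div]
      congr 1
      rw [show (9 : ℕ) = 2 * 4 + 1 by norm_num, pow_succ, pow_mul, Real.sq_sqrt hβ0.le]
    rw [e]
    refine inv_anti₀ (by positivity) ?_
    calc β ^ 4 * Real.sqrt β ≤ β ^ 4 * β := mul_le_mul_of_nonneg_left hsle (by positivity)
      _ = β ^ 5 := by ring
  have hG0 : 0 ≤ Real.exp (6 * β) * Real.sqrt (π / β) ^ 9 / (2 * π ^ 2) ^ 3 := by positivity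
  calc Real.exp (6 * β) * (β ^ 5)⁻¹ / (2 * (2 * π ^ 2) ^ 3)
      = (1 / 2) * (Real.exp (6 * β) * (β ^ 5)⁻¹ / (2 * π ^ 2) ^ 3) := by ring
    _ ≤ (1 / 2) * (Real.exp (6 * β) * Real.sqrt (π / β) ^ 9 / (2 * π ^ 2) ^ 3) := by
        refine mul_le_mul_of_nonneg_left ?_ (by norm_num)
        exact div_le_div_of_nonneg_right (mul_le_mul_of_nonneg_left hsq (Real.exp_pos _).le) (by positivity)
    _ ≤ (1 - 27 / β) * (Real.exp (6 * β) * Real.sqrt (π / β) ^ 9 / (2 * π ^ 2) ^ 3) := mul_le_mul_of_nonneg_right hhalf hG0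

/-- ★ **Hilbert–Schmidt ratio, explicit form**: for `β ≥ 54` and every `n`,
`Σ_{j≤n} (λ_j/λ_0)² ≤ (e^{8|P|+2|E|} · (5⁸(8β+1)¹⁹)^{2|E|} · (2(2π²)³β⁵)^{L³})²` on the torus `(ℤ/L)³`. [cite: ReedSimonIV1978, Thm. XIII.1] -/
theorem lat_hs_ratio_explicit {β : ℝ} (hβ : 54 ≤ β) (n : ℕ) :
    ∑ j : Fin (n + 1), (levelValue su2Rep L β j / levelValue su2Rep L β 0) ^ 2 ≤
      (Real.exp (8 * (Fintype.card (Plaquette 3 L) : ℝ) + 2 * Fintype.card (Edge 3 L)) *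
        ((5 : ℝ) ^ 8 * (8 * β + 1) ^ 19) ^ (2 * Fintype.card (Edge 3 L)) * (2 * (2 * π ^ 2) ^ 3 * β ^ 5) ^ (L ^ 3)) ^ 2 := by
  have hβ0 : 0 < β := by linarith
  have hβ1 : 1 ≤ β := by linarith
  have hπ := Real.pi_pos
  set E : ℕ := Fintype.card (Edge 3 L) with hE
  set Pq : ℕ := Fintype.card (Plaquette 3 L) with hPq
  have hE3 : E = 3 * L ^ 3 := card_edge_three L
  -- `sup K ≤ M = e^{2β|E|}`, `Σ λ_j² ≤ M²`
  set M : ℝ := Real.exp (2 * β) ^ E with hM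
  have hK : ∀ U V : GaugeConfig 3 L SU2, transferKernel su2Rep β U V ≤ M := fun U V =>
    (transferKernel_le_latE hβ0.le U V).trans (latE_le hβ0.le U V)
  have hS := sum_levelValue_sq_le (L := L) hβ0 hK n
  -- the floor `a ≤ λ_0`
  have hpoly := levelValue_zero_ge_poly (L := L) hβ1
  set lam0 := levelValue su2Rep L β 0 with hlam0
  have hlam0pos : 0 < lam0 := levelValue_zero_su2Rep_pos L β
  -- the Gaussian floor of latCE
  have hfloor : (Real.exp (6 * β) * (β ^ 5)⁻¹ / (2 * (2 * π ^ 2) ^ 3)) ^ (L ^ 3) ≤ latCE L β := by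
    refine le_trans (pow_le_pow_left₀ (by positivity) (gauss_floor_ge hβ) _) (latCE_ge_gauss_pow L (by linarith))
  -- `a := e^{-(8Pq+2E)} · P⁻¹^{2E} · floor^{L³} ≤ λ_0`
  set Pβ : ℝ := (5 : ℝ) ^ 8 * (8 * β + 1) ^ 19 with hPβ
  have hPβpos : 0 < Pβ := by positivity
  set g : ℝ := Real.exp (6 * β) * (β ^ 5)⁻¹ / (2 * (2 * π ^ 2) ^ 3) with hg
  have hgpos : 0 < g := by positivity
  set a : ℝ := Real.exp (-(8 * (Pq : ℝ) + 2 * E)) * (Pβ⁻¹) ^ (2 * E) * g ^ (L ^ 3) with ha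
  have hapos : 0 < a := by positivity
  have ha_le : a ≤ lam0 := by
    refine le_trans ?_ hpoly
    exact mul_le_mul_of_nonneg_left hfloor (by positivity)
  -- `Σ x_j² = (Σ λ_j²)/λ_0² ≤ M²/a²`
  have hsum : ∑ j : Fin (n + 1), (levelValue su2Rep L β j / lam0) ^ 2 = (∑ j : Fin (n + 1), levelValue su2Rep L β j ^ 2) / lam0 ^ 2 := by
    rw [Finset.sum_div]; refine Finset.sum_congr rfl fun j _ => ?_; rw [div_pow]
  rw [hsum, div_le_iff₀ (pow_pos hlam0pos 2)]
  have hMa : M ^ 2 ≤ (Real.exp (8 * (Pq : ℝ) + 2 * E) * Pβ ^ (2 * E) * (2 * (2 * π ^ 2) ^ 3 * β ^ 5) ^ (L ^ 3)) ^ 2 * a ^ 2 := by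
    rw [← mul_pow]
    refine pow_le_pow_left₀ (by positivity) (le_of_eq ?_) 2
    -- `M = Q · a` exactly: `e^{2βE} = (e^{6β})^{L³}` and the polynomial factors cancel
    rw [ha, hM, hg, hE3]
    have e1 : Real.exp (2 * β) ^ (3 * L ^ 3) = Real.exp (6 * β) ^ (L ^ 3) := by
      rw [← Real.exp_nat_mul, ← Real.exp_nat_mul]; congr 1; push_cast; ring
    rw [e1]
    have e2 : Real.exp (8 * (Pq : ℝ) + 2 * ((3 * L ^ 3 : ℕ) : ℝ)) * Real.exp (-(8 * (Pq : ℝ) + 2 * ((3 * L ^ 3 : ℕ) : ℝ))) = 1 := by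
      rw [← Real.exp_add, add_neg_cancel, Real.exp_zero]
    have e3 : Pβ ^ (2 * (3 * L ^ 3)) * (Pβ⁻¹) ^ (2 * (3 * L ^ 3)) = 1 := by
      rw [← mul_pow, mul_inv_cancel₀ hPβpos.ne', one_pow]
    have e4 : (2 * (2 * π ^ 2) ^ 3 * β ^ 5) ^ (L ^ 3) * (Real.exp (6 * β) * (β ^ 5)⁻¹ / (2 * (2 * π ^ 2) ^ 3)) ^ (L ^ 3) =
        Real.exp (6 * β) ^ (L ^ 3) := by
      rw [← mul_pow]; congr 1; field_simp
    calc Real.exp (6 * β) ^ (L ^ 3)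
        = 1 * 1 * Real.exp (6 * β) ^ (L ^ 3) := by ring
      _ = (Real.exp (8 * (Pq : ℝ) + 2 * ((3 * L ^ 3 : ℕ) : ℝ)) * Real.exp (-(8 * (Pq : ℝ) + 2 * ((3 * L ^ 3 : ℕ) : ℝ)))) *
            (Pβ ^ (2 * (3 * L ^ 3)) * (Pβ⁻¹) ^ (2 * (3 * L ^ 3))) *
            ((2 * (2 * π ^ 2) ^ 3 * β ^ 5) ^ (L ^ 3) * (Real.exp (6 * β) * (β ^ 5)⁻¹ / (2 * (2 * π ^ 2) ^ 3)) ^ (L ^ 3)) := by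
          rw [e2, e3, e4]
      _ = Real.exp (8 * (Pq : ℝ) + 2 * ((3 * L ^ 3 : ℕ) : ℝ)) * Pβ ^ (2 * (3 * L ^ 3)) * (2 * (2 * π ^ 2) ^ 3 * β ^ 5) ^ (L ^ 3) *
            (Real.exp (-(8 * (Pq : ℝ) + 2 * ((3 * L ^ 3 : ℕ) : ℝ))) * (Pβ⁻¹) ^ (2 * (3 * L ^ 3)) *
              (Real.exp (6 * β) * (β ^ 5)⁻¹ / (2 * (2 * π ^ 2) ^ 3)) ^ (L ^ 3)) := by ring
  have ha2 : a ^ 2 ≤ lam0 ^ 2 := pow_le_pow_left₀ hapos.le ha_le 2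
  calc ∑ j : Fin (n + 1), levelValue su2Rep L β j ^ 2 ≤ M ^ 2 := hS
    _ ≤ (Real.exp (8 * (Pq : ℝ) + 2 * E) * Pβ ^ (2 * E) * (2 * (2 * π ^ 2) ^ 3 * β ^ 5) ^ (L ^ 3)) ^ 2 * a ^ 2 := hMa
    _ ≤ (Real.exp (8 * (Pq : ℝ) + 2 * E) * Pβ ^ (2 * E) * (2 * (2 * π ^ 2) ^ 3 * β ^ 5) ^ (L ^ 3)) ^ 2 * lam0 ^ 2 :=
        mul_le_mul_of_nonneg_left ha2 (by positivity)

/-- ★ **Hilbert–Schmidt ratio on the `L³` torus** (S1 of COARSE-TAIL): there are `C`, `N`, `β₀` with `Σ_{j≤n} (λ_j/λ_0)² ≤ C·β^N` for all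
`β ≥ β₀` and all `n` (`N = 2(38|E| + 5L³) = 238L³`, `β₀ = 54`). [cite: ReedSimonIV1978, Thm. XIII.1] [cite: MontvayMunster1994, §3.2.3 (3.97) p.121] -/
theorem lat_hs_ratio : ∃ C : ℝ, ∃ N : ℕ, ∃ β0 : ℝ, ∀ β : ℝ, β0 ≤ β → ∀ n : ℕ,
    ∑ j : Fin (n + 1), (levelValue su2Rep L β j / levelValue su2Rep L β 0) ^ 2 ≤ C * β ^ N := by
  set E : ℕ := Fintype.card (Edge 3 L) with hE
  set Pq : ℕ := Fintype.card (Plaquette 3 L) with hPq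
  refine ⟨(Real.exp (8 * (Pq : ℝ) + 2 * E) * ((5 : ℝ) ^ 8 * 9 ^ 19) ^ (2 * E) * (2 * (2 * π ^ 2) ^ 3) ^ (L ^ 3)) ^ 2,
    2 * (19 * (2 * E) + 5 * L ^ 3), 54, fun β hβ n => ?_⟩
  have hβ1 : 1 ≤ β := by linarith
  have hπ := Real.pi_pos
  refine (lat_hs_ratio_explicit L hβ n).trans ?_
  -- `(8β+1)^19 ≤ (9β)^19` and regrouping of the powers of `β`
  have h9 : 8 * β + 1 ≤ 9 * β := by linarith
  have hP : (5 : ℝ) ^ 8 * (8 * β + 1) ^ 19 ≤ (5 : ℝ) ^ 8 * 9 ^ 19 * β ^ 19 := by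
    rw [mul_assoc, ← mul_pow]; exact mul_le_mul_of_nonneg_left (pow_le_pow_left₀ (by positivity) h9 19) (by positivity)
  have hQ : Real.exp (8 * (Pq : ℝ) + 2 * E) * ((5 : ℝ) ^ 8 * (8 * β + 1) ^ 19) ^ (2 * E) * (2 * (2 * π ^ 2) ^ 3 * β ^ 5) ^ (L ^ 3) ≤
      Real.exp (8 * (Pq : ℝ) + 2 * E) * ((5 : ℝ) ^ 8 * 9 ^ 19) ^ (2 * E) * (2 * (2 * π ^ 2) ^ 3) ^ (L ^ 3) * β ^ (19 * (2 * E) + 5 * L ^ 3) := by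
    have h1 : ((5 : ℝ) ^ 8 * (8 * β + 1) ^ 19) ^ (2 * E) ≤ ((5 : ℝ) ^ 8 * 9 ^ 19) ^ (2 * E) * β ^ (19 * (2 * E)) := by
      calc ((5 : ℝ) ^ 8 * (8 * β + 1) ^ 19) ^ (2 * E) ≤ ((5 : ℝ) ^ 8 * 9 ^ 19 * β ^ 19) ^ (2 * E) :=
            pow_le_pow_left₀ (by positivity) hP _
        _ = ((5 : ℝ) ^ 8 * 9 ^ 19) ^ (2 * E) * β ^ (19 * (2 * E)) := by rw [mul_pow, ← pow_mul]
    have h2 : (2 * (2 * π ^ 2) ^ 3 * β ^ 5) ^ (L ^ 3) = (2 * (2 * π ^ 2) ^ 3) ^ (L ^ 3) * β ^ (5 * L ^ 3) := by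
      rw [mul_pow, ← pow_mul]
    rw [h2, pow_add]
    have h0 : 0 ≤ Real.exp (8 * (Pq : ℝ) + 2 * E) := (Real.exp_pos _).le
    calc Real.exp (8 * (Pq : ℝ) + 2 * E) * ((5 : ℝ) ^ 8 * (8 * β + 1) ^ 19) ^ (2 * E) * ((2 * (2 * π ^ 2) ^ 3) ^ (L ^ 3) * β ^ (5 * L ^ 3))
        ≤ Real.exp (8 * (Pq : ℝ) + 2 * E) * (((5 : ℝ) ^ 8 * 9 ^ 19) ^ (2 * E) * β ^ (19 * (2 * E))) *
            ((2 * (2 * π ^ 2) ^ 3) ^ (L ^ 3) * β ^ (5 * L ^ 3)) :=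
          mul_le_mul_of_nonneg_right (mul_le_mul_of_nonneg_left h1 h0) (by positivity)
      _ = Real.exp (8 * (Pq : ℝ) + 2 * E) * ((5 : ℝ) ^ 8 * 9 ^ 19) ^ (2 * E) * (2 * (2 * π ^ 2) ^ 3) ^ (L ^ 3) *
            (β ^ (19 * (2 * E)) * β ^ (5 * L ^ 3)) := by ring
  have hQ0 : 0 ≤ Real.exp (8 * (Pq : ℝ) + 2 * E) * ((5 : ℝ) ^ 8 * (8 * β + 1) ^ 19) ^ (2 * E) * (2 * (2 * π ^ 2) ^ 3 * β ^ 5) ^ (L ^ 3) := by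
    positivity
  calc (Real.exp (8 * (Pq : ℝ) + 2 * E) * ((5 : ℝ) ^ 8 * (8 * β + 1) ^ 19) ^ (2 * E) * (2 * (2 * π ^ 2) ^ 3 * β ^ 5) ^ (L ^ 3)) ^ 2
      ≤ (Real.exp (8 * (Pq : ℝ) + 2 * E) * ((5 : ℝ) ^ 8 * 9 ^ 19) ^ (2 * E) * (2 * (2 * π ^ 2) ^ 3) ^ (L ^ 3) *
          β ^ (19 * (2 * E) + 5 * L ^ 3)) ^ 2 := pow_le_pow_left₀ hQ0 hQ _
    _ = (Real.exp (8 * (Pq : ℝ) + 2 * E) * ((5 : ℝ) ^ 8 * 9 ^ 19) ^ (2 * E) * (2 * (2 * π ^ 2) ^ 3) ^ (L ^ 3)) ^ 2 *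
          β ^ (2 * (19 * (2 * E) + 5 * L ^ 3)) := by rw [mul_pow, ← pow_mul, mul_comm (19 * (2 * E) + 5 * L ^ 3) 2]

end Summit.QuantumFields.YangMills.Theorems.FemtoTransferGap

end
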